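import Literature.AnabelianGeometry.AbsoluteAnabelian.AbsTopIProp410DensityProofs
import Literature.AnabelianGeometry.SemiGraphs.TemperedPolish
import HarnessLib

/-!
# [AbsTopI] Prop 4.10 (i) at the construction (row iii.L02, `SelfCompletionAt`) REDUCED to a
# neighbourhood-basis condition, given temperedness (proof-only)

S. Mochizuki, *Topics in Absolute Anabelian Geometry I: Generalities* [AbsTopI] (J. Math. Sci.
Univ. Tokyo 19 (2012)), Prop 4.10 (i) p. 60 ("`π₁^tp(X)` [...] is naturally isomorphic to its
`π₁(X)`-co-free completion"), §0 p. 8; manuscript pagination, lit key `paper:url-11ac98ba15fc`, read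
on the page; S. Mochizuki, *Semi-graphs of anabelioids* [SemiAnbd] Def 3.1 (i) p. 33 (tempered
groups: open normal subgroups form a basis, separate points, and compatible coset families come
from elements).  Row iii.L02 of `HOME/plan/L4/SUBDAG-AbsTopI-Prop410.md` — the input `SelfCompletionAt Y`
("(i) for `Y`") of every assembly of node (iii) (`prop410iiiAt_of_rows`, `…_of_residues`); the
cell's kit-gate ruling (abc-iut-L4-lead #3a (3)) classes it interface-level.

Here it is REDUCED, for `Π^tp_Y` TEMPERED (abc-iut-L3's parameter `IsTempered`, e.g. from
`GroupLevelData`), to the neighbourhood-basis condition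

  (CF′) every open normal subgroup of `Π^tp_Y` contains some `K_{H′} = toHat⁻¹(closure toHat(H′^{co-fr}))`
  (`CoFreeCompletion.piKer`, `H′` a Y-index),

i.e. André's definition of the tempered topology ("`Π^tp = lim Π^tp/H^{co-fr}`") modulo the profinite
closedness `K_{H′} = H′^{co-fr}` (`piKer_cofinal_of_cofreeCore_cofinal` splits (CF′) accordingly):
`selfCompletionAt_of_isTempered` (⟸), `SelfCompletionAt.exists_piKer_le` (⟹, no temperedness
needed), `selfCompletionAt_iff_of_isTempered`, `selfCompletionAt_of_groupLevelData`.  Proof of ⟸: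
`η : Π^tp_Y → lim_{H′} Π^tp_Y ⧸ K_{H′}` is injective (the `K_{H′}` are cofinal in a separating family),
surjective (a compatible family over the `K_{H′}` extends to one over ALL open normal subgroups, which
comes from an element by clause `complete`; closed subgroups are intersections of their open-normal
thickenings), continuous, and OPEN (an open normal `N ⊇ K_{H′}` is `K_{H′}`-saturated, so `η(N)` is
the preimage of the open `N/K_{H′}` under the continuous coordinate map).

Inputs are hypotheses stated in the signatures (no new named facts; FACT-LIST untouched).
HONEST FRAMING: refereed prerequisite papers; nothing here bears on [IUTchIII] Cor 3.12; typed ≠ proved.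
-/

noncomputable section

open _root_.Topology Filter

namespace Literature.AnabelianGeometry.AbsoluteAnabelian.AbsTopI.Prop410

open Literature.AnabelianGeometry.SemiGraphs
open Literature.AnabelianGeometry.AbsoluteAnabelian.AbsTopI

variable {p : ℕ} [Fact p.Prime]

/-! ### A closed subgroup of a tempered group is the intersection of its open-normal thickenings -/

/-- In a group whose open normal subgroups form a basis of neighbourhoods of `1` (a tempered group,
[SemiAnbd] Rmk 3.1.2), a CLOSED subgroup `K` satisfies `⋂_N K·N = K`: an element lying in `K·N` for
every open normal `N` lies in `K`. [cite: MochizukiSemiAnbd2006, Def 3.1(i) p.33] -/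
theorem mem_of_forall_mem_sup_openNormalSubgroup {G : Type*} [Group G] [TopologicalSpace G]
    [IsTopologicalGroup G] (hG : IsTempered G) {K : Subgroup G} (hK : IsClosed (K : Set G)) {z : G}
    (h : ∀ N : OpenNormalSubgroup G, z ∈ K ⊔ N.toSubgroup) : z ∈ K := by
  by_contra hz
  have hU : (fun w => z * w) ⁻¹' (K : Set G)ᶜ ∈ 𝓝 (1 : G) :=
    (hK.isOpen_compl.preimage (continuous_const.mul continuous_id)).mem_nhds (by simpa using hz)
  obtain ⟨N, -, hN⟩ := hG.basis _ hU
  have hzN : z ∈ ((K ⊔ N.toSubgroup : Subgroup G) : Set G) := h N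
  rw [Subgroup.mul_normal] at hzN
  obtain ⟨k, hk, n, hn, hkn⟩ := Set.mem_mul.mp hzN
  have hn' : n⁻¹ ∈ (fun w => z * w) ⁻¹' (K : Set G)ᶜ := hN (N.toSubgroup.inv_mem hn)
  apply hn'
  change z * n⁻¹ ∈ (K : Set G)
  rw [← hkn, mul_inv_cancel_right]
  exact hk

/-! ### (i) ⟹ the `K_{H′}` are cofinal among neighbourhoods of `1` -/

/-- **`SelfCompletionAt Y` ⟹ (CF′)**: every neighbourhood of `1` in `Π^tp_Y` contains some `K_{H′}`
(the topology of `Π^tp_Y` is the inverse-limit topology of the `Π^tp_Y ⧸ K_{H′}`).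
[cite: MochizukiAbsTopI2012, Prop 4.10 (i) p.60] -/
theorem SelfCompletionAt.exists_piKer_le {Y : TemperedCurve p} (hY : SelfCompletionAt Y)
    {U : Set Y.PiTemp} (hU : U ∈ 𝓝 (1 : Y.PiTemp)) :
    ∃ H' : CharOpenSubgroup Y.DeltaTemp,
      ((CoFreeCompletion.piKer ((ContinuousMonoidHom.id Y.PiHat).comp Y.toHat) Y.DeltaTemp H' :
        Subgroup Y.PiTemp) : Set Y.PiTemp) ⊆ U := by
  obtain ⟨H, V, hV, hsub⟩ := hY.exists_nhds_piKer hU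
  refine ⟨H, fun z hz => hsub z ?_⟩
  have hz1 : (z : Y.PiTemp ⧸ CoFreeCompletion.piKer ((ContinuousMonoidHom.id Y.PiHat).comp Y.toHat)
      Y.DeltaTemp H) = ((1 : Y.PiTemp) : _) := by
    rw [QuotientGroup.eq, mul_one]
    exact Subgroup.inv_mem _ hz
  rw [hz1]
  exact mem_of_mem_nhds hV

/-! ### (CF′) + temperedness ⟹ (i) -/

/-- **[AbsTopI] Prop 4.10 (i) AT THE CONSTRUCTION from temperedness and (CF′)**: if `Π^tp_Y` is
tempered ([SemiAnbd] Def 3.1 (i)) and every open normal subgroup of `Π^tp_Y` contains some `K_{H′}`,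
then the natural map `Π^tp_Y → (Π^tp_Y)^{Π̂_Y/co-fr}` is an isomorphism of topological groups
(`SelfCompletionAt Y`). [cite: MochizukiAbsTopI2012, Prop 4.10 (i) p.60] -/
theorem selfCompletionAt_of_isTempered {Y : TemperedCurve p} (hYt : IsTempered Y.PiTemp)
    (hCF : ∀ N : OpenNormalSubgroup Y.PiTemp, ∃ H' : CharOpenSubgroup Y.DeltaTemp,
      CoFreeCompletion.piKer ((ContinuousMonoidHom.id Y.PiHat).comp Y.toHat) Y.DeltaTemp H' ≤
        N.toSubgroup) :
    SelfCompletionAt Y := by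
  classical
  -- notation: `ρ = id ∘ toHat_Y`, `η : Π^tp_Y → C`
  let ρ : Y.PiTemp →ₜ* Y.PiHat := (ContinuousMonoidHom.id Y.PiHat).comp Y.toHat
  let η : Y.PiTemp →ₜ* CoFreeCompletion ρ Y.DeltaTemp := toCoFreeCompletion ρ Y.DeltaTemp
  choose I hI using hCF
  -- (1) `η` is injective
  have hinj : Function.Injective η := by
    intro y₁ y₂ h
    have hmem : ∀ H' : CharOpenSubgroup Y.DeltaTemp,
        y₁⁻¹ * y₂ ∈ CoFreeCompletion.piKer ρ Y.DeltaTemp H' := by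
      intro H'
      have h' := congrArg (CoFreeCompletion.kerCoord H') h
      rw [kerCoord_toCoFreeCompletion, kerCoord_toCoFreeCompletion, QuotientGroup.eq] at h'
      exact h'
    by_contra hne
    have hne' : y₁⁻¹ * y₂ ≠ 1 := by
      intro h1
      apply hne
      rw [← mul_inv_cancel_left y₁ y₂, h1, mul_one]
    obtain ⟨N, hN⟩ := hYt.separated _ hne'
    exact hN (hI N (hmem (I N)))
  -- (2) `η` is surjective
  have hsurj : Function.Surjective η := by
    intro c
    choose y hy using fun H' : CharOpenSubgroup Y.DeltaTemp => c.exists_toCoFreeQuot_eq_val H'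
    have hyc : ∀ H' : CharOpenSubgroup Y.DeltaTemp, CoFreeCompletion.kerCoord H' c =
        (y H' : Y.PiTemp ⧸ CoFreeCompletion.piKer ρ Y.DeltaTemp H') :=
      fun H' => CoFreeCompletion.kerCoord_eq_mk (hy H')
    -- compatibility of the chosen representatives
    have hcompat : ∀ {H' H'' : CharOpenSubgroup Y.DeltaTemp}, H'' ≤ H' →
        (y H'')⁻¹ * y H' ∈ CoFreeCompletion.piKer ρ Y.DeltaTemp H' := by
      intro H' H'' h
      rw [← QuotientGroup.eq, ← CoFreeCompletion.piKerTransition_mk ρ Y.DeltaTemp h, ← hyc H'',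
        CoFreeCompletion.piKerTransition_kerCoord h c, hyc H']
    -- the coset family over ALL open normal subgroups
    obtain ⟨g, hg⟩ := hYt.complete (fun N => (y (I N) : Y.PiTemp ⧸ N.toSubgroup)) (by
      intro N M hNM g hgN
      have hc' : (y (I N))⁻¹ * g ∈ N.toSubgroup := QuotientGroup.eq.mp hgN
      rw [QuotientGroup.eq]
      have ha : (y (I M))⁻¹ * y (I N ⊓ I M) ∈ M.toSubgroup := by
        have := hI M (hcompat (inf_le_right : I N ⊓ I M ≤ I M))
        have h2 := M.toSubgroup.inv_mem this
        rwa [mul_inv_rev, inv_inv] at h2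
      have hb : (y (I N ⊓ I M))⁻¹ * y (I N) ∈ M.toSubgroup :=
        hNM (hI N (hcompat (inf_le_left : I N ⊓ I M ≤ I N)))
      have heq : (y (I M))⁻¹ * g =
          ((y (I M))⁻¹ * y (I N ⊓ I M)) * (((y (I N ⊓ I M))⁻¹ * y (I N)) * ((y (I N))⁻¹ * g)) := by
        group
      rw [heq]
      exact M.toSubgroup.mul_mem ha (M.toSubgroup.mul_mem hb (hNM hc')))
    refine ⟨g, ?_⟩
    apply CoFreeCompletion.ext
    intro H'
    rw [← CoFreeCompletion.kerCoord_eq_iff, kerCoord_toCoFreeCompletion, hyc H', QuotientGroup.eq]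
    -- `g⁻¹ · y H' ∈ K_{H'}`: it lies in `K_{H'} · N` for every open normal `N`
    refine mem_of_forall_mem_sup_openNormalSubgroup hYt ?_ fun N => ?_
    · -- closedness of `K_{H'} = Ker(Π → Q ⧸ Ĥ'^{co-fr})`
      have hset : ((CoFreeCompletion.piKer ρ Y.DeltaTemp H' : Subgroup Y.PiTemp) : Set Y.PiTemp) =
          ρ ⁻¹' (coFreeKernel ρ H'.toSubgroup : Set Y.PiHat) := by
        ext z
        rw [SetLike.mem_coe, MonoidHom.mem_ker, Set.mem_preimage, SetLike.mem_coe]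
        change ((ρ z : Y.PiHat) : CoFreeQuot ρ H'.toSubgroup) = 1 ↔ _
        exact QuotientGroup.eq_one_iff (ρ z)
      rw [hset]
      exact (isClosed_coFreeKernel ρ H'.toSubgroup).preimage ρ.continuous
    · -- `g⁻¹ y_{H'} = (g⁻¹ y_{I N}) · ((y_{I N})⁻¹ y_{H''}) · ((y_{H''})⁻¹ y_{H'})`, `H'' = I N ⊓ H'`
      have h1 : g⁻¹ * y (I N) ∈ N.toSubgroup := by
        have := QuotientGroup.eq.mp (hg N).symm
        exact this
      have h2 : (y (I N))⁻¹ * y (I N ⊓ H') ∈ N.toSubgroup := by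
        have := hI N (hcompat (inf_le_left : I N ⊓ H' ≤ I N))
        have h2 := N.toSubgroup.inv_mem this
        rwa [mul_inv_rev, inv_inv] at h2
      have h3 : (y (I N ⊓ H'))⁻¹ * y H' ∈ CoFreeCompletion.piKer ρ Y.DeltaTemp H' :=
        hcompat (inf_le_right : I N ⊓ H' ≤ H')
      have heq : g⁻¹ * y H' =
          ((g⁻¹ * y (I N)) * ((y (I N))⁻¹ * y (I N ⊓ H'))) * ((y (I N ⊓ H'))⁻¹ * y H') := by
        group
      rw [heq]
      -- `N · K ⊆ K ⊔ N`
      exact Subgroup.mul_mem _ (Subgroup.mem_sup_right (N.toSubgroup.mul_mem h1 h2))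
        (Subgroup.mem_sup_left h3)
  -- (3) `η` is open
  have hopen : IsOpenMap η := by
    intro O hO
    rw [isOpen_iff_mem_nhds]
    rintro _ ⟨y₀, hy₀, rfl⟩
    -- an open normal `N` with `y₀ N ⊆ O`, and the index `I N`
    have hU : (fun w => y₀ * w) ⁻¹' O ∈ 𝓝 (1 : Y.PiTemp) :=
      (hO.preimage (continuous_const.mul continuous_id)).mem_nhds (by simpa using hy₀)
    obtain ⟨N, -, hN⟩ := hYt.basis _ hU
    -- the open set `{c | kerCoord_{I N} c ∈ (y₀ N) / K}` contains `η y₀` and lies in `η(O)`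
    have hWo : IsOpen ((QuotientGroup.mk : Y.PiTemp → Y.PiTemp ⧸
        CoFreeCompletion.piKer ρ Y.DeltaTemp (I N)) '' ((fun w => y₀ * w) '' (N : Set Y.PiTemp))) :=
      QuotientGroup.isOpenMap_coe _ ((Homeomorph.mulLeft y₀).isOpenMap _ N.isOpen)
    refine Filter.mem_of_superset
      ((hWo.preimage (CoFreeCompletion.continuous_kerCoord (I N))).mem_nhds ?_) ?_
    · refine ⟨y₀, ⟨1, N.toSubgroup.one_mem, by simp⟩, ?_⟩
      exact (kerCoord_toCoFreeCompletion ρ Y.DeltaTemp y₀ (I N)).symm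
    · rintro c ⟨w, ⟨n, hn, rfl⟩, hw⟩
      obtain ⟨y, rfl⟩ := hsurj c
      rw [kerCoord_toCoFreeCompletion, QuotientGroup.eq] at hw
      -- `y = (y₀ n) · ((y₀ n)⁻¹ y)` with `(y₀ n)⁻¹ y ∈ K_{I N} ⊆ N`
      have hmem : y₀⁻¹ * y ∈ (N : Set Y.PiTemp) := by
        have : y₀⁻¹ * y = n * ((y₀ * n)⁻¹ * y) := by group
        rw [this]
        exact N.toSubgroup.mul_mem hn (hI N hw)
      have hyO : y₀ * (y₀⁻¹ * y) ∈ O := hN hmem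
      rw [mul_inv_cancel_left] at hyO
      exact ⟨y, hyO, rfl⟩
  -- (4) assemble the isomorphism of topological groups
  let eM : Y.PiTemp ≃* CoFreeCompletion ρ Y.DeltaTemp := MulEquiv.ofBijective η.toMonoidHom ⟨hinj, hsurj⟩
  have hpre : ∀ O : Set Y.PiTemp, eM.symm ⁻¹' O = η '' O := by
    intro O
    ext c
    constructor
    · intro hc
      exact ⟨eM.symm c, hc, by
        change eM (eM.symm c) = c
        exact eM.apply_symm_apply c⟩
    · rintro ⟨y, hy, rfl⟩
      change eM.symm (eM y) ∈ O
      rw [eM.symm_apply_apply]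
      exact hy
  let eT : Y.PiTemp ≃ₜ* CoFreeCompletion ρ Y.DeltaTemp :=
    { eM with
      continuous_toFun := η.continuous
      continuous_invFun := by
        rw [continuous_def]
        intro O hO
        change IsOpen (eM.symm ⁻¹' O)
        rw [hpre O]
        exact hopen O hO }
  exact ⟨eT.symm, fun g => eT.symm_apply_apply g⟩

/-- **Row iii.L02 ⟺ (CF′) given temperedness**: for `Π^tp_Y` tempered, `SelfCompletionAt Y` holds iff
every open normal subgroup of `Π^tp_Y` contains some `K_{H′}`.
[cite: MochizukiAbsTopI2012, Prop 4.10 (i) p.60] -/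
theorem selfCompletionAt_iff_of_isTempered {Y : TemperedCurve p} (hYt : IsTempered Y.PiTemp) :
    SelfCompletionAt Y ↔
      ∀ N : OpenNormalSubgroup Y.PiTemp, ∃ H' : CharOpenSubgroup Y.DeltaTemp,
        CoFreeCompletion.piKer ((ContinuousMonoidHom.id Y.PiHat).comp Y.toHat) Y.DeltaTemp H' ≤
          N.toSubgroup := by
  constructor
  · intro h N
    obtain ⟨H', hH'⟩ := h.exists_piKer_le N.toOpenSubgroup.mem_nhds_one
    exact ⟨H', fun z hz => hH' hz⟩
  · exact selfCompletionAt_of_isTempered hYt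

/-- **Row iii.L02 from (CF′) under abc-iut-L3's `GroupLevelData`** ("`Π^temp` tempered").
[cite: MochizukiAbsTopI2012, Prop 4.10 (i) p.60] -/
theorem selfCompletionAt_of_groupLevelData {Y : TemperedCurve p} (dY : Y.GroupLevelData)
    (hCF : ∀ N : OpenNormalSubgroup Y.PiTemp, ∃ H' : CharOpenSubgroup Y.DeltaTemp,
      CoFreeCompletion.piKer ((ContinuousMonoidHom.id Y.PiHat).comp Y.toHat) Y.DeltaTemp H' ≤
        N.toSubgroup) :
    SelfCompletionAt Y :=
  selfCompletionAt_of_isTempered dY.isTempered hCF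

/-- **(CF′) splits** into André's definition of the tempered topology — (CF) "every open normal
subgroup of `Π^tp_Y` contains some `H′^{co-fr}`" — and the PROFINITE CLOSEDNESS
(PC) "`K_{H′} ⊆ H′^{co-fr}`" (i.e. `K_{H′} = H′^{co-fr}`: `H′^{co-fr}` is closed for the profinite
topology of `Π^tp_Y`; `H′^{co-fr} ⊆ K_{H′}` always holds, `cofreeCore_le_ker_toCoFreeQuot`).
[cite: MochizukiAbsTopI2012, Prop 4.10 (i) p.60] -/
theorem piKer_cofinal_of_cofreeCore_cofinal {Y : TemperedCurve p}
    (hbasis : ∀ N : OpenNormalSubgroup Y.PiTemp, ∃ H' : CharOpenSubgroup Y.DeltaTemp,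
      cofreeCore H'.toSubgroup ≤ N.toSubgroup)
    (hPC : ∀ H' : CharOpenSubgroup Y.DeltaTemp,
      CoFreeCompletion.piKer ((ContinuousMonoidHom.id Y.PiHat).comp Y.toHat) Y.DeltaTemp H' ≤
        cofreeCore H'.toSubgroup)
    (N : OpenNormalSubgroup Y.PiTemp) :
    ∃ H' : CharOpenSubgroup Y.DeltaTemp,
      CoFreeCompletion.piKer ((ContinuousMonoidHom.id Y.PiHat).comp Y.toHat) Y.DeltaTemp H' ≤
        N.toSubgroup := by
  obtain ⟨H', hH'⟩ := hbasis N
  exact ⟨H', (hPC H').trans hH'⟩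

end Literature.AnabelianGeometry.AbsoluteAnabelian.AbsTopI.Prop410

end
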